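import Summits.Ventures.CertifiedQuantumChemistry.Rows.HubbardRingTVHoppingMonotone
import Summits.Ventures.CertifiedQuantumChemistry.Rows.HubbardRingTVScaleHomogeneity
import Summits.Ventures.CertifiedQuantumChemistry.Rows.StrongCouplingScaledGapBound
import HarnessLib

/-!
# Ventures/CertifiedQuantumChemistry — Rows/HubbardRingTVZeroHopping.lean: at ZERO HOPPING both
# two-positivity relaxations of the half-filled ring are EXACT — `OPT_DQG = OPT_DQG+S² = E₀ = 0` —
# so the dimensionless value functions of STRUCTURE §2.2.7 vanish at `x = 0`, their maximum

HONEST FRAMING (verbatim): certified bounds for a stated model Hamiltonian in a stated basis; not a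
claim about the real molecule beyond that model.

Seat rdm-B, ROWS courtesy file (theorems only; no `def`, no notation, no instance; zero compute). The
endpoint `x = 0` of the picture typed in `Rows/HubbardRingTVHoppingSign.lean` (even in `t`),
`Rows/HubbardRingTVScaleHomogeneity.lean` (`X(t, U) = U·X(t/U, 1)`) and
`Rows/HubbardRingTVHoppingMonotone.lean` (non-increasing in `|t|`): at `t = 0` the TV-H Hamiltonian is
`U·Σ_p n_{p↑}n_{p↓} ⪰ 0`, a half-filled occupation-basis state avoids double occupancy, and on every
DQG-feasible pair the functional is `U·(total doublon weight) ≥ 0` (gen 35's a-priori bound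
`hubbardRingTV_re_rdmEnergy_ge` at `t = 0`) — so

* §1 (sector level; `L ≥ 2`, half filling `a + b = L`, `U ≥ 0`) `hubbardRingTV_re_rdmEnergy_nonneg_zero_hopping`,
  **`hubbardRingTV_pqgSectorEnergy_zero_hopping`** (`OPT_DQG(L; 0, U; a, b) = 0`),
  **`hubbardRingTV_energy_zero_hopping`** (`E₀(L; 0, U; a, b) = 0`): the `S_z`-sector relaxation is
  EXACT at zero hopping;
* §2 (singlet level; `L = 2n`, `n ≥ 1`, `U > 0`) `hubbardRingTV_pqgSingletEnergy_le_zero_of_pos` /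
  `…_of_ne_zero` (`OPT_DQG+S²(2n; t, U; n) ≤ 0` for `t ≠ 0`: unit form + the Lieb bridge chain of
  `Rows/StrongCouplingScaledGapBound.lean` + evenness), **`hubbardRingTV_pqgSingletEnergy_zero_hopping`**
  (`OPT_DQG+S²(2n; 0, U; n) = 0` — the `≤` half by CONTINUITY: the value is Lipschitz along the hopping
  line (`lipschitzWith_pqgSingletEnergy_line`) and `≤ 0` at every hopping `1/(k+1)`), hence
  `hubbardRingTV_pqgSingletEnergy_le_zero` for EVERY `t`;
* §3 `hubbardRingTV_gap_{sector,singlet}_zero_hopping` — both certified gaps VANISH at `t = 0`; with the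
  three sibling files: the dimensionless `f_X(x) = OPT_X(L; x, 1)` and `e(x) = E₀(L; x, 1)` are even,
  non-increasing in `|x|`, `≤ 0` everywhere and `= 0` at `x = 0` (nothing is claimed about other zeros,
  about the gap `e − f_X` away from `x = 0`, or about any limit).

READING: statements about the ABSTRACT programme values and the exact energy of the cell's own model
object; no certificate, row, hint, claim node or value of record depends on them; no statement about
the gap at `t ≠ 0`, its sign beyond `≥ 0`, or any limit. Everything is PROVED (0 sorry, standard axioms).

References: E. H. Lieb, Phys. Rev. Lett. 62 (1989) 1201 (Thm 2, via the tree's Lieb bridge);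
D. A. Mazziotti, Adv. Chem. Phys. 134 (2007) ch. 3 §II.A. Tree (REUSED): `StrongCouplingDoublon.hubbardRingTV_re_rdmEnergy_ge`,
`hubbardRingTV_sectorGroundEnergy_le_zero`, `hubbardRingTV_pqgSectorEnergy_le_zero`
(`Rows/HubbardRingTVDoublonBound`); `StrongCouplingGap.scaledGap_singlet_mem_Icc`
(`Rows/StrongCouplingScaledGapBound`); `pqgSectorEnergySet_nonempty`, `pqgSectorEnergy_le_sectorGroundEnergy`,
`pqgSectorEnergy_le_pqgSingletEnergy`, `lipschitzWith_pqgSingletEnergy_line` (Literature /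
`Rows/RelaxationValueConcavity`); `hubbardRingTV_pqgSingletEnergy_scale`, `…_neg_hopping`,
`HoppingMonotone.pqgSingletEnergy_tpencil` (the sibling files). Mathlib: `le_of_tendsto'`,
`tendsto_one_div_add_atTop_nhds_zero_nat`.
-/

noncomputable section

namespace Summit.Ventures.CertifiedQuantumChemistry

open Matrix Finset Filter
open Literature.MathematicalPhysics.QuantumLattice Literature.MathematicalPhysics.QuantumChemistry
open Summit.Ventures.CertifiedQuantumChemistry.Hamiltonians
open scoped ComplexOrder Topology

/-! ## §1 Sector level: `OPT_DQG(L; 0, U) = E₀(L; 0, U) = 0` at half filling -/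

/-- **At zero hopping the functional is non-negative on every feasible pair** (`U ≥ 0`, half filling
`a + b = L ≥ 2`): `Re E(γ, Γ) ≥ U · Σ_p Γ_{p↑p↓,p↑p↓} ≥ 0`. -/
theorem hubbardRingTV_re_rdmEnergy_nonneg_zero_hopping {L : ℕ} (hL : 2 ≤ L) {U : ℚ} (hU : 0 ≤ U)
    {a b : ℕ} (hN : a + b = L) {γ : Matrix (Orb (Fin L)) (Orb (Fin L)) ℂ}
    {Γ : Matrix (Orb (Fin L) × Orb (Fin L)) (Orb (Fin L) × Orb (Fin L)) ℂ}
    (hf : IsDQGFeasibleSector a b γ Γ) :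
    0 ≤ (rdmEnergy (fun p q => ((hubbardRingTV L 0 U).h p q : ℂ))
        (fun p q r s => ((hubbardRingTV L 0 U).eri p q r s : ℂ))
        ((hubbardRingTV L 0 U).ecore : ℂ) γ Γ).re := by
  have h := StrongCouplingDoublon.hubbardRingTV_re_rdmEnergy_ge hL 0 U hN hf
  have hs : 0 ≤ ∑ p : Fin L, (Γ (orb p 0, orb p 1) (orb p 0, orb p 1)).re :=
    sum_nonneg fun p _ => (Complex.nonneg_iff.1 (hf.dqg.d_psd.diag_nonneg (i := (orb p 0, orb p 1)))).1
  have hUs : 0 ≤ (U : ℝ) * ∑ p : Fin L, (Γ (orb p 0, orb p 1) (orb p 0, orb p 1)).re :=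
    mul_nonneg (by exact_mod_cast hU) hs
  simp only [Rat.cast_zero, abs_zero, mul_zero, zero_mul, sub_zero] at h
  exact hUs.trans h

/-- **THE `S_z`-SECTOR DQG VALUE AT ZERO HOPPING IS `0`** (`U ≥ 0`, half filling `a + b = L ≥ 2`):
`OPT_DQG(hubbardRingTV L 0 U; a, b) = 0` (`≥ 0` on every feasible pair; `≤ E₀ ≤ 0`). -/
theorem hubbardRingTV_pqgSectorEnergy_zero_hopping {L : ℕ} (hL : 2 ≤ L) {U : ℚ} (hU : 0 ≤ U)
    {a b : ℕ} (hN : a + b = L) :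
    Model.pqgSectorEnergy (hubbardRingTV L 0 U) a b = 0 := by
  have ha : a ≤ Fintype.card (Fin L) := by rw [Fintype.card_fin]; omega
  have hb : b ≤ Fintype.card (Fin L) := by rw [Fintype.card_fin]; omega
  refine le_antisymm (StrongCouplingDoublon.hubbardRingTV_pqgSectorEnergy_le_zero 0 U hN) ?_
  show (0 : ℝ) ≤ pqgSectorEnergy _ _ _ a b
  unfold pqgSectorEnergy
  refine le_csInf (pqgSectorEnergySet_nonempty _ _ _ ha hb) ?_
  rintro E ⟨γ, Γ, hf, rfl⟩
  exact hubbardRingTV_re_rdmEnergy_nonneg_zero_hopping hL hU hN hf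

/-- **THE EXACT SECTOR ENERGY AT ZERO HOPPING IS `0`** (`U ≥ 0`, half filling `a + b = L ≥ 2`):
`E₀(hubbardRingTV L 0 U; a, b) = 0` (a half-filled occupation-basis state has no double occupancy;
below, `E₀ ≥ OPT_DQG = 0`). -/
theorem hubbardRingTV_energy_zero_hopping {L : ℕ} (hL : 2 ≤ L) {U : ℚ} (hU : 0 ≤ U)
    {a b : ℕ} (hN : a + b = L) :
    Model.energy (hubbardRingTV L 0 U) a b = 0 := by
  have ha : a ≤ Fintype.card (Fin L) := by rw [Fintype.card_fin]; omega
  have hb : b ≤ Fintype.card (Fin L) := by rw [Fintype.card_fin]; omega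
  refine le_antisymm (StrongCouplingDoublon.hubbardRingTV_sectorGroundEnergy_le_zero 0 U hN) ?_
  have h := pqgSectorEnergy_le_sectorGroundEnergy (hubbardRingTV_hamiltonian_isHermitian L 0 U) ha hb
  have h0 := hubbardRingTV_pqgSectorEnergy_zero_hopping hL hU hN
  unfold Model.pqgSectorEnergy at h0
  rw [h0] at h
  exact h

/-- **The sector gap vanishes at zero hopping**: `E₀ − OPT_DQG = 0` for `hubbardRingTV L 0 U` at half
filling (`U ≥ 0`, `L ≥ 2`) — the `S_z`-sector relaxation is exact there. -/
theorem hubbardRingTV_gap_sector_zero_hopping {L : ℕ} (hL : 2 ≤ L) {U : ℚ} (hU : 0 ≤ U)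
    {a b : ℕ} (hN : a + b = L) :
    Model.energy (hubbardRingTV L 0 U) a b - Model.pqgSectorEnergy (hubbardRingTV L 0 U) a b = 0 := by
  rw [hubbardRingTV_energy_zero_hopping hL hU hN, hubbardRingTV_pqgSectorEnergy_zero_hopping hL hU hN,
    sub_zero]

/-! ## §2 Singlet level: `OPT_DQG+S²(2n; 0, U) = 0` -/

/-- `OPT_DQG+S²(2n; t, U; n) ≤ 0` for `t > 0`, `U > 0`, `n ≥ 1`: the unit form `t·OPT_DQG+S²(2n; 1, U/t)`
and the chain `OPT_DQG+S² ≤ E₀(n, n) ≤ 0` at `t = 1` (singlet-restricted relaxation ≤ singlet energy =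
sector energy by Lieb's theorem, `Rows/StrongCouplingScaledGapBound.lean`; `E₀ ≤ 0` by the
occupation-basis trial state). -/
theorem hubbardRingTV_pqgSingletEnergy_le_zero_of_pos {n : ℕ} (hn : 1 ≤ n) {t U : ℚ} (ht : 0 < t)
    (hU : 0 < U) :
    Model.pqgSingletEnergy (hubbardRingTV (2 * n) t U) n ≤ 0 := by
  have h1 : hubbardRingTV (2 * n) t U = hubbardRingTV (2 * n) (t * 1) (t * (U / t)) := by
    rw [mul_one, mul_div_cancel₀ U ht.ne']
  rw [h1, hubbardRingTV_pqgSingletEnergy_scale (2 * n) ht.le 1 (U / t) n]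
  have hUt : 0 < U / t := div_pos hU ht
  obtain ⟨hlo, -⟩ := StrongCouplingGap.scaledGap_singlet_mem_Icc hn hUt
  have hE : Model.energy (hubbardRingTV (2 * n) 1 (U / t)) n n ≤ 0 :=
    StrongCouplingDoublon.hubbardRingTV_sectorGroundEnergy_le_zero 1 (U / t) (by ring)
  have hpos : (0 : ℝ) < ((U / t : ℚ) : ℝ) / 4 := by
    have : (0 : ℝ) < ((U / t : ℚ) : ℝ) := by exact_mod_cast hUt
    linarith
  have hOE : Model.pqgSingletEnergy (hubbardRingTV (2 * n) 1 (U / t)) n ≤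
      Model.energy (hubbardRingTV (2 * n) 1 (U / t)) n n :=
    sub_nonneg.1 ((mul_nonneg_iff_of_pos_left hpos).1 hlo)
  have ht' : (0 : ℝ) ≤ (t : ℝ) := by exact_mod_cast ht.le
  have := mul_le_mul_of_nonneg_left (hOE.trans hE) ht'
  rwa [mul_zero] at this

/-- `OPT_DQG+S²(2n; t, U; n) ≤ 0` for every `t ≠ 0` (`U > 0`, `n ≥ 1`; negative `t` by evenness,
`Rows/HubbardRingTVHoppingSign.lean`). -/
theorem hubbardRingTV_pqgSingletEnergy_le_zero_of_ne_zero {n : ℕ} (hn : 1 ≤ n) {t U : ℚ} (ht : t ≠ 0)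
    (hU : 0 < U) :
    Model.pqgSingletEnergy (hubbardRingTV (2 * n) t U) n ≤ 0 := by
  rcases lt_or_gt_of_ne ht with hlt | hgt
  · rw [← hubbardRingTV_pqgSingletEnergy_neg_hopping (even_two_mul n), ← neg_neg t, neg_neg (-t)]
    exact hubbardRingTV_pqgSingletEnergy_le_zero_of_pos hn (neg_pos.2 hlt) hU
  · exact hubbardRingTV_pqgSingletEnergy_le_zero_of_pos hn hgt hU

/-- **THE SINGLET-RESTRICTED DQG VALUE AT ZERO HOPPING IS `0`** (`L = 2n`, `n ≥ 1`, `U > 0`):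
`OPT_DQG+S²(hubbardRingTV (2n) 0 U; n) = 0`. The `≥` half: `≥ OPT_DQG = 0`; the `≤` half by
CONTINUITY — the value is Lipschitz along the hopping line and `≤ 0` at the hoppings `1/(k+1) → 0`. -/
theorem hubbardRingTV_pqgSingletEnergy_zero_hopping {n : ℕ} (hn : 1 ≤ n) {U : ℚ} (hU : 0 < U) :
    Model.pqgSingletEnergy (hubbardRingTV (2 * n) 0 U) n = 0 := by
  have hnk : n ≤ Fintype.card (Fin (2 * n)) := by rw [Fintype.card_fin]; omega
  refine le_antisymm ?_ ?_
  · -- continuity along the hopping pencil `T(0, U) + s·T(1, 0)`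
    have hlip := lipschitzWith_pqgSingletEnergy_line
      (fun p q => (((hubbardRingTV (2 * n) 0 U).h p q : ℚ) : ℂ))
      (fun p q => (((hubbardRingTV (2 * n) 1 0).h p q : ℚ) : ℂ))
      (fun p q r s => (((hubbardRingTV (2 * n) 0 U).eri p q r s : ℚ) : ℂ))
      (fun p q r s => (((hubbardRingTV (2 * n) 1 0).eri p q r s : ℚ) : ℂ))
      (((hubbardRingTV (2 * n) 0 U).ecore : ℚ) : ℂ) (((hubbardRingTV (2 * n) 1 0).ecore : ℚ) : ℂ) hnk
    have hseq : Tendsto (fun k : ℕ => (1 : ℝ) / ((k : ℝ) + 1)) atTop (𝓝 0) :=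
      tendsto_one_div_add_atTop_nhds_zero_nat
    have hlim := (hlip.continuous.tendsto 0).comp hseq
    rw [HoppingMonotone.pqgSingletEnergy_tpencil, Rat.cast_zero]
    refine le_of_tendsto' hlim fun k => ?_
    have hq : (1 : ℝ) / ((k : ℝ) + 1) = (((1 / ((k : ℚ) + 1) : ℚ)) : ℝ) := by push_cast; ring
    have hqpos : (0 : ℚ) < 1 / ((k : ℚ) + 1) := by positivity
    have hle := hubbardRingTV_pqgSingletEnergy_le_zero_of_pos hn hqpos hU
    rw [HoppingMonotone.pqgSingletEnergy_tpencil] at hle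
    simp only [Function.comp_apply]
    rw [hq]
    exact hle
  · rw [← hubbardRingTV_pqgSectorEnergy_zero_hopping (L := 2 * n) (by omega) hU.le (show n + n = 2 * n by ring)]
    exact pqgSectorEnergy_le_pqgSingletEnergy _ _ _ hnk

/-- **`OPT_DQG+S²(2n; t, U; n) ≤ 0` for EVERY hopping `t`** (`U > 0`, `n ≥ 1`). -/
theorem hubbardRingTV_pqgSingletEnergy_le_zero {n : ℕ} (hn : 1 ≤ n) (t : ℚ) {U : ℚ} (hU : 0 < U) :
    Model.pqgSingletEnergy (hubbardRingTV (2 * n) t U) n ≤ 0 := by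
  rcases eq_or_ne t 0 with rfl | ht
  · exact (hubbardRingTV_pqgSingletEnergy_zero_hopping hn hU).le
  · exact hubbardRingTV_pqgSingletEnergy_le_zero_of_ne_zero hn ht hU

/-- **The singlet gap vanishes at zero hopping**: `E₀(n, n) − OPT_DQG+S² = 0` for `hubbardRingTV (2n) 0 U`
(`U > 0`, `n ≥ 1`) — the singlet-restricted relaxation is exact there too. -/
theorem hubbardRingTV_gap_singlet_zero_hopping {n : ℕ} (hn : 1 ≤ n) {U : ℚ} (hU : 0 < U) :
    Model.energy (hubbardRingTV (2 * n) 0 U) n n - Model.pqgSingletEnergy (hubbardRingTV (2 * n) 0 U) n = 0 := by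
  rw [hubbardRingTV_energy_zero_hopping (L := 2 * n) (by omega) hU.le (show n + n = 2 * n by ring),
    hubbardRingTV_pqgSingletEnergy_zero_hopping hn hU, sub_zero]

end Summit.Ventures.CertifiedQuantumChemistry

end
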